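import Mathlib
import Summits.PneNP.PneNP.Theorems.ConvexRankGatesConvexGateBlindRainbowMarginals

/-!
# PneNP / ConvexRankGates — `ConvexGateBlind`: the level-`t` rainbow functional (small colour classes), I: sums

Helpers (`--supports stmt-PneNP-10680`). The one-clump functional `rbL` of `…RainbowFunctional.lean` has the inclusion
numbers of "a uniformly random `(K+1)`-set meeting every class at most once" at ALL levels `≤ K`, but needs classes of
size `n ≥ K + 1` (clumps of every size up to `K + 1` must fit into a class). This file and `…RainbowLevel.lean` construct,
for every level `t ≤ K - 1`, a one-clump functional `rbLt` with clumps of size `≤ t + 2` only and clump weights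

  `w_t(j) = (-1)^j (t+2) C(t,j) / ((K+1) C(K-1,j) (j+1)(j+2) C(n,j+2))`   (clump size `j + 2`, `j ≤ t`),

which for classes of common size `n ≥ t + 2` has EXACTLY the inclusion numbers of `rbL` on all sets of size `≤ t`
(`rbLt_indicator` in `…RainbowLevel.lean`). Here: the alternating identity `∑_i (-1)^i C(T,i) C(N-i,s) = [T ≤ s] C(N-T, s-T)`
(`alt_sum_choose_choose_sub`) and its three consequences (vanishing against `C(j,r)`, the `1/(j+1)` and `1/((j+1)(j+2))`
sums), the functional `rbLt` with its linearity, and the per-class class sum (`rbLt_class_sum`, registered stub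
`rainbow_level_class_sum`): with `T' = T ∖ cls i`, `H = h(T')`, `κ = #(T ∩ cls i)` the class-`i` part of `L_t(𝟙[T ⊆ ·])` is
`[T' rainbow] n^{K-#T'}/C(n,κ) · ∑_{j ≤ t} (-1)^j (t+2) C(t,j) C(K-1-#H, j) C(j+2,κ) / ((K+1) C(K-1,j) (j+1)(j+2))`
(pinned-fibre product and superset counts of `…RainbowFunctional.lean`). [new]
-/

namespace Summit.PneNP.PneNP.Theorems

open Finset

set_option linter.dupNamespace false

noncomputable section

variable {m K : ℕ}

/-! ## One alternating identity and three consequences -/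

/-- `∑_{i ≤ T} (-1)^i C(T,i) C(N-i, s) = [T ≤ s] · C(N-T, s-T)` for `T ≤ N` (iterated Pascal differences of `i ↦ C(N-i,s)`).
[folklore] -/
theorem alt_sum_choose_choose_sub (T s N : ℕ) (hTN : T ≤ N) :
    ∑ i ∈ range (T + 1), (-1 : ℝ) ^ i * (T.choose i : ℝ) * ((N - i).choose s : ℝ) =
      if T ≤ s then (((N - T).choose (s - T) : ℕ) : ℝ) else 0 := by
  induction T generalizing N with
  | zero => simp
  | succ T ih =>
    have hPascal : ∀ i, (-1 : ℝ) ^ (i + 1) * ((T + 1).choose (i + 1) : ℝ) * ((N - (i + 1)).choose s : ℝ) =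
        (-1 : ℝ) ^ (i + 1) * (T.choose (i + 1) : ℝ) * ((N - (i + 1)).choose s : ℝ) -
          (-1 : ℝ) ^ i * (T.choose i : ℝ) * ((N - 1 - i).choose s : ℝ) := by
      intro i
      rw [Nat.choose_succ_succ', Nat.cast_add, show N - (i + 1) = N - 1 - i by omega, pow_succ]
      ring
    have h1 := Finset.sum_range_succ' (fun i => (-1 : ℝ) ^ i * ((T + 1).choose i : ℝ) * ((N - i).choose s : ℝ)) (T + 1)
    have h2 := Finset.sum_range_succ' (fun i => (-1 : ℝ) ^ i * (T.choose i : ℝ) * ((N - i).choose s : ℝ)) (T + 1)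
    have h3 := Finset.sum_range_succ (fun i => (-1 : ℝ) ^ i * (T.choose i : ℝ) * ((N - i).choose s : ℝ)) (T + 1)
    have h4 : ∑ i ∈ range (T + 1), (-1 : ℝ) ^ (i + 1) * ((T + 1).choose (i + 1) : ℝ) * ((N - (i + 1)).choose s : ℝ) =
        (∑ i ∈ range (T + 1), (-1 : ℝ) ^ (i + 1) * (T.choose (i + 1) : ℝ) * ((N - (i + 1)).choose s : ℝ)) -
          ∑ i ∈ range (T + 1), (-1 : ℝ) ^ i * (T.choose i : ℝ) * ((N - 1 - i).choose s : ℝ) := by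
      rw [← Finset.sum_sub_distrib]
      exact Finset.sum_congr rfl fun i _ => hPascal i
    simp only [pow_zero, Nat.choose_zero_right, Nat.cast_one, one_mul, Nat.sub_zero, Nat.choose_succ_self,
      Nat.cast_zero, mul_zero, zero_mul, add_zero] at h1 h2 h3
    have hsplit : ∑ i ∈ range (T + 1 + 1), (-1 : ℝ) ^ i * ((T + 1).choose i : ℝ) * ((N - i).choose s : ℝ) =
        (∑ i ∈ range (T + 1), (-1 : ℝ) ^ i * (T.choose i : ℝ) * ((N - i).choose s : ℝ)) -
          ∑ i ∈ range (T + 1), (-1 : ℝ) ^ i * (T.choose i : ℝ) * ((N - 1 - i).choose s : ℝ) := by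
      linarith [h1, h2, h3, h4]
    rw [hsplit, ih N (by omega), ih (N - 1) (by omega)]
    by_cases hle : T + 1 ≤ s
    · rw [if_pos (by omega : T ≤ s), if_pos (by omega : T ≤ s), if_pos hle]
      have hs : s - T = (s - (T + 1)) + 1 := by omega
      have hN : N - T = (N - 1 - T) + 1 := by omega
      rw [hs, hN, Nat.choose_succ_succ', Nat.cast_add, show N - (T + 1) = N - 1 - T by omega,
        show s - (T + 1) + 1 = s - T by omega]
      ring
    · by_cases hle' : T ≤ s
      · have hsT : s = T := by omega
        subst hsT
        rw [if_pos le_rfl, if_pos le_rfl, if_neg hle]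
        simp
      · rw [if_neg hle', if_neg hle', if_neg hle]
        ring

/-- Vanishing: `∑_{j ≤ t} (-1)^j C(t,j) C(j,r) C(N-j, s) = 0` when `r + s < t ≤ N`
(a `t`-th difference of a polynomial of degree `r + s`). [folklore] -/
theorem alt_sum_choose_mul_choose_choose_sub (t r s N : ℕ) (hrs : r + s < t) (htN : t ≤ N) :
    ∑ j ∈ range (t + 1), (-1 : ℝ) ^ j * (t.choose j : ℝ) * (j.choose r : ℝ) * ((N - j).choose s : ℝ) = 0 := by
  have hrt : r ≤ t := by omega
  -- split off the vanishing initial segment `j < r`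
  rw [Finset.range_eq_Ico]
  rw [← Finset.sum_Ico_consecutive _ (Nat.zero_le r) (by omega : r ≤ t + 1)]
  have hzero : ∑ j ∈ Ico 0 r, (-1 : ℝ) ^ j * (t.choose j : ℝ) * (j.choose r : ℝ) * ((N - j).choose s : ℝ) = 0 := by
    refine Finset.sum_eq_zero fun j hj => ?_
    rw [Nat.choose_eq_zero_of_lt (mem_Ico.1 hj).2]
    simp
  rw [hzero, zero_add, Finset.sum_Ico_eq_sum_range, show t + 1 - r = (t - r) + 1 by omega]
  -- `C(t, r+i) C(r+i, r) = C(t, r) C(t-r, i)`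
  have hterm : ∀ i ∈ range (t - r + 1),
      (-1 : ℝ) ^ (r + i) * (t.choose (r + i) : ℝ) * ((r + i).choose r : ℝ) * ((N - (r + i)).choose s : ℝ) =
        ((-1 : ℝ) ^ r * (t.choose r : ℝ)) *
          ((-1 : ℝ) ^ i * ((t - r).choose i : ℝ) * (((N - r) - i).choose s : ℝ)) := by
    intro i hi
    have hi' : r + i ≤ t := by have := mem_range.1 hi; omega
    have hmul := Nat.choose_mul (n := t) (Nat.le_add_right r i)
    -- hmul : t.choose (r+i) * (r+i).choose r = t.choose r * (t - r).choose (r + i - r)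
    rw [show r + i - r = i by omega] at hmul
    have hmul' : (t.choose (r + i) : ℝ) * ((r + i).choose r : ℝ) = (t.choose r : ℝ) * ((t - r).choose i : ℝ) := by
      exact_mod_cast hmul
    rw [show N - (r + i) = N - r - i by omega, pow_add]
    calc (-1 : ℝ) ^ r * (-1) ^ i * (t.choose (r + i) : ℝ) * ((r + i).choose r : ℝ) * ((N - r - i).choose s : ℝ)
        = (-1 : ℝ) ^ r * (-1) ^ i * ((t.choose (r + i) : ℝ) * ((r + i).choose r : ℝ)) * ((N - r - i).choose s : ℝ) := by
          ring
      _ = _ := by rw [hmul']; ring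
  rw [Finset.sum_congr rfl hterm, ← Finset.mul_sum, alt_sum_choose_choose_sub (t - r) s (N - r) (by omega),
    if_neg (by omega), mul_zero]

/-- `∑_{j ≤ t} (-1)^j C(t,j) C(N-j, s) / (j+1) = C(N+1, s) / (t+1)` for `s ≤ t ≤ N`. [folklore] -/
theorem alt_sum_choose_choose_sub_div_succ (t s N : ℕ) (hst : s ≤ t) (htN : t ≤ N) :
    ∑ j ∈ range (t + 1), (-1 : ℝ) ^ j * (t.choose j : ℝ) * ((N - j).choose s : ℝ) / ((j : ℝ) + 1) =
      ((N + 1).choose s : ℝ) / ((t : ℝ) + 1) := by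
  have ht1 : (t : ℝ) + 1 ≠ 0 := by positivity
  -- `(t+1) C(t,j) / (j+1) = C(t+1, j+1)`
  have hterm : ∀ j ∈ range (t + 1),
      (-1 : ℝ) ^ j * (t.choose j : ℝ) * ((N - j).choose s : ℝ) / ((j : ℝ) + 1) =
        (1 / ((t : ℝ) + 1)) * ((-1 : ℝ) ^ j * ((t + 1).choose (j + 1) : ℝ) * ((N - j).choose s : ℝ)) := by
    intro j _
    have hj1 : (j : ℝ) + 1 ≠ 0 := by positivity
    have h := Nat.add_one_mul_choose_eq t j
    -- h : (t + 1) * t.choose j = (t + 1).choose (j + 1) * (j + 1)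
    have h' : ((t : ℝ) + 1) * (t.choose j : ℝ) = ((t + 1).choose (j + 1) : ℝ) * ((j : ℝ) + 1) := by
      exact_mod_cast h
    have hq : (t.choose j : ℝ) / ((j : ℝ) + 1) = ((t + 1).choose (j + 1) : ℝ) / ((t : ℝ) + 1) := by
      rw [div_eq_div_iff hj1 ht1]; linarith
    calc (-1 : ℝ) ^ j * (t.choose j : ℝ) * ((N - j).choose s : ℝ) / ((j : ℝ) + 1)
        = (-1 : ℝ) ^ j * ((N - j).choose s : ℝ) * ((t.choose j : ℝ) / ((j : ℝ) + 1)) := by ring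
      _ = (-1 : ℝ) ^ j * ((N - j).choose s : ℝ) * (((t + 1).choose (j + 1) : ℝ) / ((t : ℝ) + 1)) := by rw [hq]
      _ = _ := by ring
  rw [Finset.sum_congr rfl hterm, ← Finset.mul_sum]
  -- the full alternating sum for `t + 1` vanishes
  have hV := alt_sum_choose_choose_sub (t + 1) s (N + 1) (by omega)
  rw [if_neg (by omega), Finset.sum_range_succ'] at hV
  simp only [pow_zero, Nat.choose_zero_right, Nat.cast_one, one_mul, Nat.sub_zero] at hV
  have hshift : ∑ j ∈ range (t + 1), (-1 : ℝ) ^ j * ((t + 1).choose (j + 1) : ℝ) * ((N - j).choose s : ℝ) =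
      -∑ j ∈ range (t + 1), (-1 : ℝ) ^ (j + 1) * ((t + 1).choose (j + 1) : ℝ) * ((N + 1 - (j + 1)).choose s : ℝ) := by
    rw [← Finset.sum_neg_distrib]
    refine Finset.sum_congr rfl fun j _ => ?_
    rw [show N + 1 - (j + 1) = N - j by omega, pow_succ]
    ring
  rw [hshift]
  have : ∑ j ∈ range (t + 1), (-1 : ℝ) ^ (j + 1) * ((t + 1).choose (j + 1) : ℝ) * ((N + 1 - (j + 1)).choose s : ℝ) =
      -((N + 1).choose s : ℝ) := by linarith
  rw [this, neg_neg]
  field_simp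

/-- `∑_{j ≤ t} (-1)^j C(t,j) C(N-j, s) / ((j+1)(j+2)) = C(N+1,s)/(t+1) - C(N+2,s)/((t+1)(t+2))` for `s ≤ t ≤ N`. [folklore] -/
theorem alt_sum_choose_choose_sub_div_succ_succ (t s N : ℕ) (hst : s ≤ t) (htN : t ≤ N) :
    ∑ j ∈ range (t + 1), (-1 : ℝ) ^ j * (t.choose j : ℝ) * ((N - j).choose s : ℝ) / (((j : ℝ) + 1) * ((j : ℝ) + 2)) =
      ((N + 1).choose s : ℝ) / ((t : ℝ) + 1) - ((N + 2).choose s : ℝ) / (((t : ℝ) + 1) * ((t : ℝ) + 2)) := by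
  have ht1 : (t : ℝ) + 1 ≠ 0 := by positivity
  have ht2 : (t : ℝ) + 2 ≠ 0 := by positivity
  -- `(t+1)(t+2) C(t,j) / ((j+1)(j+2)) = C(t+2, j+2)`
  have hterm : ∀ j ∈ range (t + 1),
      (-1 : ℝ) ^ j * (t.choose j : ℝ) * ((N - j).choose s : ℝ) / (((j : ℝ) + 1) * ((j : ℝ) + 2)) =
        (1 / (((t : ℝ) + 1) * ((t : ℝ) + 2))) *
          ((-1 : ℝ) ^ j * ((t + 2).choose (j + 2) : ℝ) * ((N - j).choose s : ℝ)) := by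
    intro j _
    have hj1 : (j : ℝ) + 1 ≠ 0 := by positivity
    have hj2 : (j : ℝ) + 2 ≠ 0 := by positivity
    have h1 := Nat.add_one_mul_choose_eq t j
    have h2 := Nat.add_one_mul_choose_eq (t + 1) (j + 1)
    have h1' : ((t : ℝ) + 1) * (t.choose j : ℝ) = ((t + 1).choose (j + 1) : ℝ) * ((j : ℝ) + 1) := by
      exact_mod_cast h1
    have h2' : ((t : ℝ) + 1 + 1) * ((t + 1).choose (j + 1) : ℝ) =
        ((t + 1 + 1).choose (j + 1 + 1) : ℝ) * ((j : ℝ) + 1 + 1) := by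
      exact_mod_cast h2
    have h22 : (t + 1 + 1).choose (j + 1 + 1) = (t + 2).choose (j + 2) := rfl
    rw [h22] at h2'
    have hq : (t.choose j : ℝ) / (((j : ℝ) + 1) * ((j : ℝ) + 2)) =
        ((t + 2).choose (j + 2) : ℝ) / (((t : ℝ) + 1) * ((t : ℝ) + 2)) := by
      rw [div_eq_div_iff (by positivity) (by positivity)]
      linear_combination ((t : ℝ) + 2) * h1' + ((j : ℝ) + 1) * h2'
    calc (-1 : ℝ) ^ j * (t.choose j : ℝ) * ((N - j).choose s : ℝ) / (((j : ℝ) + 1) * ((j : ℝ) + 2))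
        = (-1 : ℝ) ^ j * ((N - j).choose s : ℝ) * ((t.choose j : ℝ) / (((j : ℝ) + 1) * ((j : ℝ) + 2))) := by ring
      _ = (-1 : ℝ) ^ j * ((N - j).choose s : ℝ) * (((t + 2).choose (j + 2) : ℝ) / (((t : ℝ) + 1) * ((t : ℝ) + 2))) := by
          rw [hq]
      _ = _ := by ring
  rw [Finset.sum_congr rfl hterm, ← Finset.mul_sum]
  -- the full alternating sum for `t + 2` vanishes; peel off the terms `i = 0, 1`
  have hV := alt_sum_choose_choose_sub (t + 2) s (N + 2) (by omega)
  rw [if_neg (by omega), Finset.sum_range_succ', Finset.sum_range_succ'] at hV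
  simp only [pow_zero, Nat.choose_zero_right, Nat.cast_one, one_mul, Nat.sub_zero, zero_add, pow_one,
    Nat.choose_one_right] at hV
  have hshift : ∑ j ∈ range (t + 1), (-1 : ℝ) ^ j * ((t + 2).choose (j + 2) : ℝ) * ((N - j).choose s : ℝ) =
      ∑ j ∈ range (t + 1), (-1 : ℝ) ^ (j + 1 + 1) * ((t + 2).choose (j + 1 + 1) : ℝ) *
        ((N + 2 - (j + 1 + 1)).choose s : ℝ) := by
    refine Finset.sum_congr rfl fun j _ => ?_
    rw [show N + 2 - (j + 1 + 1) = N - j by omega, pow_succ, pow_succ]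
    ring
  rw [hshift]
  have hN21 : N + 2 - 1 = N + 1 := by omega
  rw [hN21] at hV
  have : ∑ j ∈ range (t + 1), (-1 : ℝ) ^ (j + 1 + 1) * ((t + 2).choose (j + 1 + 1) : ℝ) *
      ((N + 2 - (j + 1 + 1)).choose s : ℝ) = ((t + 2 : ℕ) : ℝ) * ((N + 1).choose s : ℝ) - ((N + 2).choose s : ℝ) := by
    linarith
  rw [this]
  push_cast
  field_simp

/-- Exchange identity `C(N,a) C(N-a,b) = C(N,b) C(N-b,a)` (both count ordered pairs of disjoint subsets). [folklore] -/
theorem choose_mul_choose_sub_comm (N a b : ℕ) :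
    (N.choose a : ℝ) * ((N - a).choose b : ℝ) = (N.choose b : ℝ) * ((N - b).choose a : ℝ) := by
  have h1 := Nat.choose_mul (n := N) (Nat.le_add_right a b)
  have h2 := Nat.choose_mul (n := N) (Nat.le_add_left b a)
  rw [show a + b - a = b by omega, Nat.choose_symm_add] at h1
  rw [show a + b - b = a by omega] at h2
  have : N.choose a * (N - a).choose b = N.choose b * (N - b).choose a := by rw [← h1, ← h2]
  exact_mod_cast this

/-! ## The level-`t` one-clump functional -/

/-- The level-`t` clump weight for clump size `j + 2`:
`w_t(j) = (-1)^j (t+2) C(t,j) / ((K+1) C(K-1,j) (j+1)(j+2) C(n,j+2))` (zero for `j > t`). -/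
def clumpWtL (K n t j : ℕ) : ℝ :=
  (-1 : ℝ) ^ j * ((t : ℝ) + 2) * (t.choose j : ℝ) /
    (((K : ℝ) + 1) * ((K - 1).choose j : ℝ) * (((j : ℝ) + 1) * ((j : ℝ) + 2)) * (n.choose (j + 2) : ℝ))

/-- The LEVEL-`t` ONE-CLUMP FUNCTIONAL `L_t`: as `rbL`, but only clumps of size `j + 2 ≤ t + 2` (colour sets `Γ` of the
complementary size `K - 1 - j`), weighted by `clumpWtL`. -/
def rbLt (h : Fin m → Fin K) (n t : ℕ) (f : Finset (Fin m) → ℝ) : ℝ :=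
  ∑ i : Fin K, ∑ j ∈ range (t + 1), ∑ Γ ∈ (univ.erase i).powersetCard (K - 1 - j),
    ∑ C ∈ (cls h i).powersetCard (j + 2),
      clumpWtL K n t j * ∑ x ∈ Fintype.piFinset (fun c => cls h c), f (C ∪ Γ.image x)

/-- `L_t` depends only on the function (pointwise). -/
theorem rbLt_congr_fun (h : Fin m → Fin K) (n t : ℕ) {f f' : Finset (Fin m) → ℝ} (hff' : ∀ Q, f Q = f' Q) :
    rbLt h n t f = rbLt h n t f' := by
  rw [show f = f' from funext hff']

/-- `L_t` is linear: subtraction. -/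
theorem rbLt_sub (h : Fin m → Fin K) (n t : ℕ) (f f' : Finset (Fin m) → ℝ) :
    rbLt h n t (fun Q => f Q - f' Q) = rbLt h n t f - rbLt h n t f' := by
  simp only [rbLt, Finset.sum_sub_distrib, mul_sub]

/-- `L_t` is linear: addition. -/
theorem rbLt_add (h : Fin m → Fin K) (n t : ℕ) (f f' : Finset (Fin m) → ℝ) :
    rbLt h n t (fun Q => f Q + f' Q) = rbLt h n t f + rbLt h n t f' := by
  simp only [rbLt, Finset.sum_add_distrib, mul_add]

/-- `L_t(0) = 0`. -/
theorem rbLt_zero (h : Fin m → Fin K) (n t : ℕ) : rbLt h n t (fun _ => 0) = 0 := by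
  simp [rbLt]

/-- `L_t` is linear: finite sums. -/
theorem rbLt_sum {ι : Type*} [DecidableEq ι] (s : Finset ι) (h : Fin m → Fin K) (n t : ℕ)
    (f : ι → Finset (Fin m) → ℝ) :
    rbLt h n t (fun Q => ∑ l ∈ s, f l Q) = ∑ l ∈ s, rbLt h n t (f l) := by
  induction s using Finset.induction_on with
  | empty => simpa using rbLt_zero h n t
  | insert a s ha ih =>
    rw [Finset.sum_insert ha, ← ih, ← rbLt_add]
    exact rbLt_congr_fun h n t (fun Q => by rw [Finset.sum_insert ha])

/-- `L_t` is linear: scalars. -/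
theorem rbLt_smul (h : Fin m → Fin K) (n t : ℕ) (a : ℝ) (f : Finset (Fin m) → ℝ) :
    rbLt h n t (fun Q => a * f Q) = a * rbLt h n t f := by
  simp only [rbLt, Finset.mul_sum]
  refine Finset.sum_congr rfl fun _ _ => Finset.sum_congr rfl fun _ _ => Finset.sum_congr rfl fun _ _ =>
    Finset.sum_congr rfl fun _ _ => Finset.sum_congr rfl fun _ _ => by ring

/-- `L_t` only sees the values of `f` on `(K+1)`-sets (`t + 1 ≤ K`). -/
theorem rbLt_congr (h : Fin m → Fin K) (n : ℕ) {t : ℕ} (htK : t + 1 ≤ K) {f f' : Finset (Fin m) → ℝ}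
    (hff' : ∀ Q : Finset (Fin m), Q.card = K + 1 → f Q = f' Q) : rbLt h n t f = rbLt h n t f' := by
  unfold rbLt
  refine Finset.sum_congr rfl fun i _ => Finset.sum_congr rfl fun j hj => Finset.sum_congr rfl fun Γ hΓ =>
    Finset.sum_congr rfl fun C hC => ?_
  congr 1
  refine Finset.sum_congr rfl fun x hx => hff' _ ?_
  have hjt : j < t + 1 := mem_range.1 hj
  have hC' : C ∈ (cls h i).powersetCard (K + 1 - (K - 1 - j)) := by
    rw [show K + 1 - (K - 1 - j) = j + 2 by omega]; exact hC
  exact card_clump_union_image hΓ hC' hx (by omega)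

/-! ## Per-class evaluation of `L_t(𝟙[T ⊆ ·])` -/

/-- **Per-class class sum.** With `T_i = T ∩ cls i`, `T' = T ∖ T_i`, `H = h(T')`, `κ = #T_i`: the class-`i` part of
`L_t(𝟙[T ⊆ ·])` equals `[T' rainbow] n^{K-#T'} / C(n,κ) · ∑_{j ≤ t} (-1)^j (t+2) C(t,j) C(K-1-#H, j) C(j+2, κ) /
((K+1) C(K-1,j) (j+1)(j+2))` (classes of size `n ≥ t + 2`, `t + 1 ≤ K`). -/
theorem rbLt_class_sum (h : Fin m → Fin K) {n t : ℕ} (hn : ∀ c, (cls h c).card = n) (htn : t + 2 ≤ n)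
    (htK : t + 1 ≤ K) (T : Finset (Fin m)) (i : Fin K) :
    (∑ j ∈ range (t + 1), ∑ Γ ∈ (univ.erase i).powersetCard (K - 1 - j), ∑ C ∈ (cls h i).powersetCard (j + 2),
        clumpWtL K n t j * ∑ x ∈ Fintype.piFinset (fun c => cls h c),
          (if T ⊆ C ∪ Γ.image x then (1 : ℝ) else 0)) =
      (if Set.InjOn h ↑(T.filter fun v => h v ≠ i) then (n : ℝ) ^ (K - (T.filter fun v => h v ≠ i).card) else 0) /
          (n.choose (T.filter fun v => h v = i).card : ℝ) *
        ∑ j ∈ range (t + 1), (-1 : ℝ) ^ j * ((t : ℝ) + 2) * (t.choose j : ℝ) *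
          ((K - 1 - ((T.filter fun v => h v ≠ i).image h).card).choose j : ℝ) *
          ((j + 2).choose (T.filter fun v => h v = i).card : ℝ) /
            (((K : ℝ) + 1) * ((K - 1).choose j : ℝ) * (((j : ℝ) + 1) * ((j : ℝ) + 2))) := by
  classical
  set T' := T.filter fun v => h v ≠ i with hT'
  set Ti := T.filter fun v => h v = i with hTi
  set H := T'.image h with hHdef
  set P : ℝ := if Set.InjOn h ↑T' then (n : ℝ) ^ (K - T'.card) else 0 with hP
  have hHsub : H ⊆ univ.erase i := by
    intro c hc
    obtain ⟨v, hv, rfl⟩ := mem_image.1 hc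
    exact mem_erase.2 ⟨(mem_filter.1 hv).2, mem_univ _⟩
  have hTisub : Ti ⊆ cls h i := fun v hv => mem_cls.2 (mem_filter.1 hv).2
  have hHK : H.card < K := by
    have h1 := card_le_card hHsub
    rw [card_erase_of_mem (mem_univ _), card_univ, Fintype.card_fin] at h1
    omega
  have hκn : Ti.card ≤ n := (card_le_card hTisub).trans (hn i).le
  have hCnκ : (n.choose Ti.card : ℝ) ≠ 0 := by
    have := Nat.choose_pos hκn
    positivity
  rw [Finset.mul_sum]
  refine Finset.sum_congr rfl fun j hj => ?_
  have hjt : j < t + 1 := mem_range.1 hj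
  have hjK : j < K := by omega
  -- Step 1: the `x`-sums
  have step1 : ∀ Γ ∈ (univ.erase i).powersetCard (K - 1 - j), ∀ C ∈ (cls h i).powersetCard (j + 2),
      clumpWtL K n t j * (∑ x ∈ Fintype.piFinset (fun c => cls h c), (if T ⊆ C ∪ Γ.image x then (1 : ℝ) else 0)) =
        clumpWtL K n t j * (if Ti ⊆ C ∧ H ⊆ Γ then P else 0) := by
    intro Γ hΓ C hC
    have hiΓ : i ∉ Γ := fun hi => by
      have := (mem_powersetCard.1 hΓ).1 hi
      simp at this
    have hCsub : C ⊆ cls h i := (mem_powersetCard.1 hC).1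
    rw [rbL_sum_pi_indicator h hiΓ hCsub T, card_piFinset_pinFib h hn T i]
    have hiff : (∀ v ∈ T, h v ≠ i → h v ∈ Γ) ↔ H ⊆ Γ := by
      rw [hHdef, Finset.image_subset_iff]
      simp only [hT', mem_filter, and_imp]
    rw [← hT', ← hTi]
    congr 1
    by_cases hA : Ti ⊆ C
    · by_cases hB : H ⊆ Γ
      · rw [if_pos (show Ti ⊆ C ∧ (∀ v ∈ T, h v ≠ i → h v ∈ Γ) from ⟨hA, hiff.2 hB⟩),
          if_pos (show Ti ⊆ C ∧ H ⊆ Γ from ⟨hA, hB⟩), hP]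
        push_cast
        rfl
      · rw [if_neg (fun hh : Ti ⊆ C ∧ (∀ v ∈ T, h v ≠ i → h v ∈ Γ) => hB (hiff.1 hh.2)),
          if_neg (fun hh : Ti ⊆ C ∧ H ⊆ Γ => hB hh.2)]
    · rw [if_neg (fun hh : Ti ⊆ C ∧ (∀ v ∈ T, h v ≠ i → h v ∈ Γ) => hA hh.1),
        if_neg (fun hh : Ti ⊆ C ∧ H ⊆ Γ => hA hh.1)]
  rw [Finset.sum_congr rfl fun Γ hΓ => Finset.sum_congr rfl fun C hC => step1 Γ hΓ C hC]
  -- Step 2: split the double sum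
  rw [sum_sum_ite_and]
  -- Step 3: the two counts
  have hNΓ := card_colourSets_superset hHsub (K - 1 - j)
  have hNΓ' : (((((univ.erase i).powersetCard (K - 1 - j)).filter fun Γ => H ⊆ Γ).card : ℕ) : ℝ) =
      ((K - 1 - H.card).choose j : ℝ) := by
    rw [hNΓ]
    exact colourSets_count_reflect H hHK hjK
  have hNC := card_clumps_superset h hn i hTisub (j + 2)
  have hCn2 : (n.choose (j + 2) : ℝ) ≠ 0 := by
    have := Nat.choose_pos (show j + 2 ≤ n by omega)
    positivity
  have hCK : ((K - 1).choose j : ℝ) ≠ 0 := by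
    have := Nat.choose_pos (show j ≤ K - 1 by omega)
    positivity
  -- Step 4: algebra
  rw [hNΓ']
  have hj1 : (j : ℝ) + 1 ≠ 0 := by positivity
  have hj2 : (j : ℝ) + 2 ≠ 0 := by positivity
  have hK1 : (K : ℝ) + 1 ≠ 0 := by positivity
  have hNC' : ((((cls h i).powersetCard (j + 2)).filter fun C => Ti ⊆ C).card : ℝ) =
      (n.choose (j + 2) : ℝ) * ((j + 2).choose Ti.card : ℝ) / (n.choose Ti.card : ℝ) := by
    rw [eq_div_iff hCnκ, hNC]
  rw [hNC', clumpWtL]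
  field_simp


/-- **Registered helper stub (per-class class sum of the level-`t` functional).** Restatement of `rbLt_class_sum` with all
parameters explicit. -/
theorem rainbow_level_class_sum : ∀ {m K n t : ℕ} (h : Fin m → Fin K), (∀ c, (cls h c).card = n) → t + 2 ≤ n → t + 1 ≤ K → ∀ (T : Finset (Fin m)) (i : Fin K), (∑ j ∈ Finset.range (t + 1), ∑ Γ ∈ (Finset.univ.erase i).powersetCard (K - 1 - j), ∑ C ∈ (cls h i).powersetCard (j + 2), clumpWtL K n t j * ∑ x ∈ Fintype.piFinset (fun c => cls h c), (if T ⊆ C ∪ Γ.image x then (1 : ℝ) else 0)) = (if Set.InjOn h ↑(T.filter fun v => h v ≠ i) then (n : ℝ) ^ (K - (T.filter fun v => h v ≠ i).card) else 0) / (n.choose (T.filter fun v => h v = i).card : ℝ) * ∑ j ∈ Finset.range (t + 1), (-1 : ℝ) ^ j * ((t : ℝ) + 2) * (t.choose j : ℝ) * ((K - 1 - ((T.filter fun v => h v ≠ i).image h).card).choose j : ℝ) * ((j + 2).choose (T.filter fun v => h v = i).card : ℝ) / (((K : ℝ) + 1) * ((K - 1).choose j : ℝ) * (((j : ℝ) +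 1) * ((j : ℝ) + 2))) := by
  intro m K n t h hn htn htK T i
  exact rbLt_class_sum h hn htn htK T i

end

end Summit.PneNP.PneNP.Theorems
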